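import Summits.BirchSwinnertonDyer.Rank1Residual.X11b.KolyvaginShaOrderByName
import Summits.BirchSwinnertonDyer.BirchSwinnertonDyer.Theses.ClassRecordThree
import HarnessLib

/-!
# Route `ClassRecordThree`, support item `ClassicalInputsThree` (stmt-BirchSwinnertonDyer-19411): its
# conjunct 3 — Kolyvagin's INDEX bound `Kolyvagin1990_padicValNat_card_sha_le N_E W K` — on the class
# X11b @ `p`, FROM its conjunct 2 (`kolyvagin`), the shared item 20191 `ShimuraCasselsTateLevelInputs`
# and two Gross 1991 named facts (`--supports stmt-BirchSwinnertonDyer-19411`)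

Cell `b2b-bsdres`, seat x11b3-p2 GEN 55 (unit claimed D-0075 → BSD:K2/P4 «Kolyvagin-in-kernel»).
Summit-side THEOREM-ONLY helper file (no definition, no named fact, no `sorry`); the LINE (D-0145) is
the declared support item 19411 of route `ClassRecordThree` (twin conjunct in `KolyvaginRoadThree`'s
`PublishedInputsKolyThree`; item 20191 is SHARED by both routes and by `ErratumRoadFive`).

HONEST FRAMING (cell `b2b-bsdres`, run/shared/lean/b2b/bsd-rank1-residual/, verbatim in every
file): the goal of the cell is to DELETE the COMBINATION-SHAPED residual classes of the
Birch–Swinnerton-Dyer formula for ALL analytic-rank `≤ 1` elliptic curves over `ℚ` — "full BSD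
formula for every rank `≤ 1` curve in class `C`" assembled STRICTLY from published theorems — so
that the rank-`≤ 1` remainder becomes exactly the CONSTRUCTION-SHAPED classes, which are TYPED
(missing-input `Prop`s), NOT attempted.  This is not "finishing BSD".  Nothing here is booked; no
mark / label / count / tier moves; the support item stays a conjunction of named facts (this file
neither closes nor restates it); BSD is not proved by any of this; no census number moves (T7).

WHAT THIS FILE SAYS.  The K2@3 kernels consume Kolyvagin's quantitative theorem BY NAME as conjunct 3
of `ClassicalInputsThree` ∕ `PublishedInputsKolyThree`, `∀ N W K, Kolyvagin1990_padicValNat_card_sha_le N W K`,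
and apply it at `N = N_E`, a globally minimal `W` of class X11b @ `p` and a Heegner field `K` with
`d_K ∉ {−3, −4}`.  At exactly that shape the conjunct is a KERNEL CONSEQUENCE
(`Summits/BirchSwinnertonDyer/Rank1Residual/X11b/KolyvaginShaOrderByName.lean`, x11b3-p2 GEN 55, on
the x11b3 transcription of McCallum 1991 §§1–5 and Gross 1991 §§3–6) of: conjunct 2
(`∀ N W K, kolyvagin N W K`, the QUALITATIVE Kolyvagin theorem: rank one makes the index finite, `Ш`
finite makes `ord_p #Ш = ord_p #Ш[p^∞]`), the route's own item 20191
`ShimuraCasselsTateLevelInputs` (= `∀ K, casselsTate_levelInputs K`, the levelwise Cassels–Tate ∕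
local-duality inputs), and the two Gross 1991 named facts `Gross1991_heegnerPoint_sub_ratTorsion_mem_E0`
(§6 ∕ [GZ86 III (3.1)]) and `GrossLMS1991.prop37_2_frobeniusCongruence` (Prop. 3.7 (2), closed
image-free print).  Two readings: from the four inputs as separate binders, and from the item's own
`Prop` `Theses.ClassRecordThree.ClassicalInputsThree` (projection `.2.1`) — the latter shows that,
INSIDE item 19411, conjunct 3 restricted to the class and to `d_K ∉ {−3, −4}` carries no content
beyond conjunct 2 + item 20191 + the two Gross facts.  CONDITIONAL on those named facts (PUBLISHED,
NOT discharged); the unrestricted conjunct 3 (`d_K ∈ {−3, −4}`, `N ≠ N_E`, CM curves) is NOT derived.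

References: [cite: McCallumLMS1991, §1 Theorem (Kolyvagin), Lemma 5.1, Thm. 5.4, Cor. 5.6]
[cite: GrossLMS1991, Thm. 1.3, §3 Prop. 3.7 (2), §6 Prop. 6.2 (1)] [cite: MilneADT2006, Ch. I §6, Thm. 6.13(a)]
[cite: KolyvaginEulerSystems1990, Thm. A]
-/

noncomputable section

-- Same namespace as the x11b3 kernel theorems it wraps (`X11b/KolyvaginShaOrderByName.lean`).
namespace Summit.BirchSwinnertonDyer.Rank1Residual.X11b.KolyvaginDischarged

open Literature.NumberTheory.EllipticCurves
open Literature.NumberTheory.EllipticCurves.GrossLMS1991 (prop37_2_frobeniusCongruence)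
open Summit.BirchSwinnertonDyer.Rank1Residual
open Summit.BirchSwinnertonDyer.BirchSwinnertonDyer.Theses.ClassRecordThree
  (ClassicalInputsThree ShimuraCasselsTateLevelInputs)

/-- **Conjunct 3 of `ClassicalInputsThree` on the class X11b @ `p`, from conjunct 2, item 20191 and
two Gross 1991 named facts.**  For every globally minimal elliptic `W/ℚ` with `(E, p) ∈ ClassX11b W p`
and every number field `K` with `d_K ∉ {−3, −4}`:
`Kolyvagin1990_padicValNat_card_sha_le (W.conductorNorm ℤ) W K` (McCallum 1991 §1 Theorem (Kolyvagin):
`ord_q #Ш(E/K) ≤ 2 · ord_q [E(K) : ℤ y_K]` for every non-torsion Heegner point and every odd prime `q`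
with `ρ̄_{E,q}` onto), GIVEN `∀ N W K, kolyvagin N W K` (conjunct 2), the route item
`ShimuraCasselsTateLevelInputs` (20191), `Gross1991_heegnerPoint_sub_ratTorsion_mem_E0` and
`prop37_2_frobeniusCongruence`.  One line on `kolyvagin1990_padicValNat_card_sha_le_of_classX11b_of_namedFacts`.
CONDITIONAL on the four named facts (PUBLISHED, NOT discharged); item 19411 is neither closed nor
restated; nothing booked. [cite: McCallumLMS1991, §1 Theorem (Kolyvagin), p. 296]
[cite: GrossLMS1991, §3 Prop. 3.7 (2), §6 Prop. 6.2 (1)] [cite: MilneADT2006, Ch. I §6, Thm. 6.13(a)] -/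
theorem classRecordThree_kolyvagin1990IndexBound_of_kolyvagin_of_shimuraCasselsTateLevelInputs_of_gross1991
    (hKo : ∀ (N : ℕ) [NeZero N] (W : WeierstrassCurve ℚ) (K : Type) [Field K] [NumberField K],
      kolyvagin N W K)
    (hCT : ShimuraCasselsTateLevelInputs)
    (hE0 : Gross1991_heegnerPoint_sub_ratTorsion_mem_E0) (hγ : prop37_2_frobeniusCongruence)
    (W : WeierstrassCurve ℚ) [W.IsElliptic] [W.IsGloballyMinimal] [NeZero (W.conductorNorm ℤ)]
    {p : ℕ} [Fact p.Prime] (hX : ClassX11b W p) (K : Type) [Field K] [NumberField K]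
    (hD : NumberField.discr K ≠ -3 ∧ NumberField.discr K ≠ -4) :
    Kolyvagin1990_padicValNat_card_sha_le (W.conductorNorm ℤ) W K := by
  -- tactic form (the unfolded fact carries its own `[W.IsElliptic]` binder)
  intro _ hK hH P hP hnt q hq hq2 hρ
  exact kolyvagin1990_padicValNat_card_sha_le_of_classX11b_of_namedFacts hKo hE0 hγ hCT W hX K hD hK hH
    hP hnt hq hq2 hρ

/-- **The same reading INSIDE item 19411**: from the item's own `Prop` `ClassicalInputsThree` (only its
conjunct 2 `∀ N W K, kolyvagin N W K` is used — projection `.2.1`), the shared item 20191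
`ShimuraCasselsTateLevelInputs` and the two Gross 1991 named facts, conjunct 3 at
`(N_E, W, K)` for every `(E, p) ∈ ClassX11b W p` (`W` globally minimal) and every `K` with
`d_K ∉ {−3, −4}`.  CONDITIONAL; item 19411 neither closed nor restated; nothing booked.
[cite: McCallumLMS1991, §1 Theorem (Kolyvagin), p. 296] [cite: GrossLMS1991, §3 Prop. 3.7 (2), §6 Prop. 6.2 (1)] -/
theorem classRecordThree_kolyvagin1990IndexBound_of_classicalInputsThree_of_shimuraCasselsTateLevelInputs_of_gross1991
    (h : ClassicalInputsThree) (hCT : ShimuraCasselsTateLevelInputs)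
    (hE0 : Gross1991_heegnerPoint_sub_ratTorsion_mem_E0) (hγ : prop37_2_frobeniusCongruence)
    (W : WeierstrassCurve ℚ) [W.IsElliptic] [W.IsGloballyMinimal] [NeZero (W.conductorNorm ℤ)]
    {p : ℕ} [Fact p.Prime] (hX : ClassX11b W p) (K : Type) [Field K] [NumberField K]
    (hD : NumberField.discr K ≠ -3 ∧ NumberField.discr K ≠ -4) :
    Kolyvagin1990_padicValNat_card_sha_le (W.conductorNorm ℤ) W K := by
  intro _ hK hH P hP hnt q hq hq2 hρ
  exact classRecordThree_kolyvagin1990IndexBound_of_kolyvagin_of_shimuraCasselsTateLevelInputs_of_gross1991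
    h.2.1 hCT hE0 hγ W hX K hD hK hH hP hnt hq hq2 hρ

end Summit.BirchSwinnertonDyer.Rank1Residual.X11b.KolyvaginDischarged

end
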